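import Mathlib.Tactic.Group
import Mathlib.Tactic.Ring
import Mathlib.Logic.Equiv.Sum
import Mathlib.Data.Fintype.BigOperators
import Summits.MatrixMultiplication.MatrixMultiplication.Theses.ReesMunnRealization
import Literature.Computability.AlgebraicComplexity.CohnUmansTPP

/-!
# `BrandtNoGain` — single-`𝒟`-class (Brandt) hosts buy nothing over their group

Route `MatrixMultiplication/ReesMunnRealization`, item `stmt-MatrixMultiplication-4376` (support):
a strict realization `(φ, ψ, χ)` of `⟨a, b, e⟩` in the Brandt semigroup
`B(G, n) = M⁰(G; n, n; Id)` (non-zero elements `(r, g, λ) ∈ [n] × G × [n]`, product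
`(r, g, λ)(ι, h, γ) = (r, g h, γ)` if `λ = ι` and `0` otherwise) satisfies
`a b e ≤ n³ · a' b' e'` for some triple `(a', b', e')` that `G` realizes through the triple product
property (`Literature.Computability.AlgebraicComplexity.RealizesTPP`).

Proof (three steps, all elementary).

1. *Index functions.* The diagonal products `φ(i,j) ψ(j,k) = χ(i,k) ≠ 0` force the row index of
   `φ(i,j)` and of `χ(i,k)` to be a function `R i`, the column index of `ψ(j,k)` and of `χ(i,k)`
   to be a function `C k`, and the inner indices (column of `φ(i,j)` = row of `ψ(j,k)`) to be a
   function `M j`.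
2. *Fibres realize in the group.* For fixed `(ρ, μ, ν) ∈ [n]³` the `G`-components of `φ, ψ, χ`
   restricted to the fibres `S_ρ = R⁻¹(ρ)`, `T_μ = M⁻¹(μ)`, `U_ν = C⁻¹(ν)` form a strict
   realization of `⟨|S_ρ|, |T_μ|, |U_ν|⟩` in the GROUP `G` (inside the fibres every cross product
   `φ(i,j) ψ(j',k)` is non-zero and has the row/column indices of `χ(i',k')`, so the Brandt
   strictness is exactly the group strictness), and a strict realization in a group comes from a
   TPP triple of the same sizes (`realizesTPP_of_realization`, the structure argument
   `f i j = sᵢ τⱼ`, `g j k = τⱼ⁻¹ uₖ`, `h i k = sᵢ uₖ` of Cohn–Umans: realizations of `⟨ℓ, m, n⟩`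
   in the group basis of `ℂ[G]` are exactly TPP triples, Cohn–Umans 2013, Prop. 10 /
   Cohn–Umans 2003, §2).
3. *Pigeonhole.* Taking `ρ, μ, ν` to be largest fibres, `a ≤ n |S_ρ|`, `b ≤ n |T_μ|`,
   `e ≤ n |U_ν|`, whence `a b e ≤ n³ |S_ρ| |T_μ| |U_ν|`.

The degenerate case `a b e = 0` is witnessed by the empty triple `(0, 0, 0)`.
-/

-- single-conjunct summit: the mandated namespace `Summit.MatrixMultiplication.MatrixMultiplication.…`
-- repeats `MatrixMultiplication` (summit = sub-problem), which `linter.dupNamespace` would flag.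
set_option linter.dupNamespace false

namespace Summit.MatrixMultiplication.MatrixMultiplication.Theorems

open Finset Literature.Computability.AlgebraicComplexity

/-- **Strict realizations in a group are TPP triples** (Cohn–Umans: a realization of `⟨ℓ, m, n⟩`
in the group basis is a triple-product-property triple; Cohn–Umans 2013, Prop. 10, "⇒" direction,
= the structure argument of Cohn–Umans 2003, §2). If `f : α × β → G`, `g : β × γ → G`,
`h : α × γ → G` on non-empty finite index types satisfy `f(i,j) g(j,k) = h(i,k)` and
`f(i,j) g(j',k) = h(i',k') ⟹ i = i', j = j', k = k'`, then with `sᵢ = f(i,j₀)`, `uₖ = g(j₀,k)`,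
`τⱼ = s_{i₀}⁻¹ f(i₀,j)` one has `f(i,j) = sᵢ τⱼ`, `g(j,k) = τⱼ⁻¹ uₖ`, `h(i,k) = sᵢ uₖ`, and
`S = {sᵢ⁻¹}`, `T = {τⱼ}`, `U = {uₖ}` is a TPP triple with `|S| = |α|`, `|T| = |β|`, `|U| = |γ|`,
so `G` realizes `⟨|α|, |β|, |γ|⟩`. [cite: CohnUmans2003, §2] -/
theorem realizesTPP_of_realization {G : Type*} [Group G] {α β γ : Type*} [Fintype α] [Fintype β]
    [Fintype γ] (f : α → β → G) (g : β → γ → G) (h : α → γ → G) (i₀ : α) (j₀ : β) (k₀ : γ)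
    (hdiag : ∀ i j k, f i j * g j k = h i k)
    (hstrict : ∀ i i' j j' k k', f i j * g j' k = h i' k' → i = i' ∧ j = j' ∧ k = k') :
    RealizesTPP G (Fintype.card α) (Fintype.card β) (Fintype.card γ) := by
  classical
  obtain ⟨s, hs⟩ : ∃ s : α → G, ∀ i, s i = f i j₀ := ⟨_, fun _ => rfl⟩
  obtain ⟨u, hu⟩ : ∃ u : γ → G, ∀ k, u k = g j₀ k := ⟨_, fun _ => rfl⟩
  obtain ⟨τ, hτ⟩ : ∃ τ : β → G, ∀ j, τ j = (s i₀)⁻¹ * f i₀ j := ⟨_, fun _ => rfl⟩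
  have hh : ∀ i k, h i k = s i * u k := fun i k => by rw [hs, hu, hdiag]
  have hg : ∀ j k, g j k = (τ j)⁻¹ * u k := fun j k => by
    have e1 := hdiag i₀ j k
    rw [hh] at e1
    rw [hτ]
    calc g j k = (f i₀ j)⁻¹ * (f i₀ j * g j k) := by group
      _ = (f i₀ j)⁻¹ * (s i₀ * u k) := by rw [e1]
      _ = ((s i₀)⁻¹ * f i₀ j)⁻¹ * u k := by group
  have hf : ∀ i j, f i j = s i * τ j := fun i j => by
    have e1 := hdiag i j k₀
    rw [hh, hg] at e1
    calc f i j = f i j * ((τ j)⁻¹ * u k₀) * ((u k₀)⁻¹ * τ j) := by group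
      _ = s i * u k₀ * ((u k₀)⁻¹ * τ j) := by rw [e1]
      _ = s i * τ j := by group
  refine ⟨univ.image fun i => (s i)⁻¹, univ.image τ, univ.image u, ?_, ?_, ?_, ?_⟩
  · rw [card_image_of_injective _ ?_, card_univ]
    intro i i' hii'
    have e1 : f i j₀ = f i' j₀ := by rw [← hs, ← hs]; exact inv_injective hii'
    exact (hstrict i i' j₀ j₀ k₀ k₀ (by rw [e1, hdiag])).1
  · rw [card_image_of_injective _ ?_, card_univ]
    intro j j' hjj'
    have e1 : f i₀ j = f i₀ j' := by
      have e2 : τ j = τ j' := hjj'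
      rw [hτ, hτ] at e2
      exact mul_left_cancel e2
    exact (hstrict i₀ i₀ j j' k₀ k₀ (by rw [e1, hdiag])).2.1
  · rw [card_image_of_injective _ ?_, card_univ]
    intro k k' hkk'
    have e1 : g j₀ k = g j₀ k' := by rw [← hu, ← hu]; exact hkk'
    exact (hstrict i₀ i₀ j₀ j₀ k k' (by rw [e1, hdiag])).2.2
  · intro x hx x' hx' y hy y' hy' z hz z' hz' heq
    simp only [mem_image, mem_univ, true_and] at hx hx' hy hy' hz hz'
    obtain ⟨i', rfl⟩ := hx
    obtain ⟨i, rfl⟩ := hx'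
    obtain ⟨j, rfl⟩ := hy
    obtain ⟨j', rfl⟩ := hy'
    obtain ⟨k, rfl⟩ := hz
    obtain ⟨k', rfl⟩ := hz'
    have key : f i j * g j' k = h i' k' := by
      rw [hf i j, hg j' k, hh i' k']
      calc s i * τ j * ((τ j')⁻¹ * u k)
          = s i' * ((s i')⁻¹ * ((s i)⁻¹)⁻¹ * (τ j * (τ j')⁻¹) * (u k * (u k')⁻¹)) * u k' := by
            group
        _ = s i' * u k' := by rw [heq, mul_one]
    obtain ⟨rfl, rfl, rfl⟩ := hstrict i i' j j' k k' key
    exact ⟨rfl, rfl, rfl⟩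

/-- **Largest fibre pigeonhole**: if the fibre of `F : Fin m → Fin n` over `ρ` is at least as large
as every other fibre, then `m ≤ n · |F⁻¹(ρ)|` (`m = ∑_{ρ'} |F⁻¹(ρ')| ≤ n · |F⁻¹(ρ)|`). [folklore] -/
theorem le_mul_card_fiber {m n : ℕ} (F : Fin m → Fin n) (ρ : Fin n)
    (hmax : ∀ ρ', Fintype.card {x // F x = ρ'} ≤ Fintype.card {x // F x = ρ}) :
    m ≤ n * Fintype.card {x // F x = ρ} := by
  calc m = Fintype.card (Σ ρ' : Fin n, {x : Fin m // F x = ρ'}) := by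
        rw [Fintype.card_congr (Equiv.sigmaFiberEquiv F), Fintype.card_fin]
    _ = ∑ ρ' : Fin n, Fintype.card {x : Fin m // F x = ρ'} := Fintype.card_sigma
    _ ≤ ∑ _ρ' : Fin n, Fintype.card {x : Fin m // F x = ρ} := sum_le_sum fun ρ' _ => hmax ρ'
    _ = n * Fintype.card {x : Fin m // F x = ρ} := by
        rw [sum_const, card_univ, Fintype.card_fin, smul_eq_mul]

/-- **`BrandtNoGain`** (settles `stmt-MatrixMultiplication-4376`, exact route signature
`Summit.MatrixMultiplication.MatrixMultiplication.Theses.ReesMunnRealization.BrandtNoGain`):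
a strict realization of `⟨a, b, e⟩` in the Brandt semigroup `B(G, n) = M⁰(G; n, n; Id)` gives
`a b e ≤ n³ · a' b' e'` for a triple `(a', b', e')` realized by `G` through the triple product
property.  Index functions `R, M, C` (step 1), the largest fibres `S_ρ, T_μ, U_ν` (step 3,
`le_mul_card_fiber`) and the group realization carried by the fibres (step 2,
`realizesTPP_of_realization`). [folklore] -/
theorem brandtNoGain_proof :
    Summit.MatrixMultiplication.MatrixMultiplication.Theses.ReesMunnRealization.BrandtNoGain := by
  unfold Summit.MatrixMultiplication.MatrixMultiplication.Theses.ReesMunnRealization.BrandtNoGain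
  intro G _ _ _ n a b e φ ψ χ H
  by_cases habe : a * b * e = 0
  · refine ⟨0, 0, 0, ⟨∅, ∅, ∅, card_empty, card_empty, card_empty, fun x hx => by simp at hx⟩, ?_⟩
    rw [habe]
    exact Nat.zero_le _
  -- non-degenerate case: base points
  have ha : 0 < a := Nat.pos_of_ne_zero (by rintro rfl; simp at habe)
  have hb : 0 < b := Nat.pos_of_ne_zero (by rintro rfl; simp at habe)
  have he : 0 < e := Nat.pos_of_ne_zero (by rintro rfl; simp at habe)
  obtain ⟨i₀⟩ : Nonempty (Fin a) := ⟨⟨0, ha⟩⟩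
  obtain ⟨j₀⟩ : Nonempty (Fin b) := ⟨⟨0, hb⟩⟩
  obtain ⟨k₀⟩ : Nonempty (Fin e) := ⟨⟨0, he⟩⟩
  -- the diagonal products: `φ(i,j) ψ(j,k) = χ(i,k) ≠ 0`
  have hd : ∀ i j k, (φ (i, j)).2.2 = (ψ (j, k)).1 ∧
      ((φ (i, j)).1, (φ (i, j)).2.1 * (ψ (j, k)).2.1, (ψ (j, k)).2.2) = χ (i, k) := by
    intro i j k
    have h0 := (H (i, j) (j, k) (i, k)).2 ⟨rfl, rfl, rfl⟩
    by_cases hc : (φ (i, j)).2.2 = (ψ (j, k)).1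
    · rw [if_pos hc] at h0
      exact ⟨hc, Option.some_injective _ h0⟩
    · rw [if_neg hc] at h0
      exact (Option.some_ne_none _ h0.symm).elim
  -- step 1: index functions
  obtain ⟨R, hR⟩ : ∃ R : Fin a → Fin n, ∀ i, R i = (χ (i, k₀)).1 := ⟨_, fun _ => rfl⟩
  obtain ⟨M, hM⟩ : ∃ M : Fin b → Fin n, ∀ j, M j = (φ (i₀, j)).2.2 := ⟨_, fun _ => rfl⟩
  obtain ⟨C, hC⟩ : ∃ C : Fin e → Fin n, ∀ k, C k = (χ (i₀, k)).2.2 := ⟨_, fun _ => rfl⟩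
  have hcomp : ∀ i j k, (φ (i, j)).1 = (χ (i, k)).1 ∧
      (φ (i, j)).2.1 * (ψ (j, k)).2.1 = (χ (i, k)).2.1 ∧ (ψ (j, k)).2.2 = (χ (i, k)).2.2 := by
    intro i j k
    have h1 := congrArg Prod.fst (hd i j k).2
    have h2 := congrArg (fun t => t.2.1) (hd i j k).2
    have h3 := congrArg (fun t => t.2.2) (hd i j k).2
    exact ⟨h1, h2, h3⟩
  have F1 : ∀ i j, (φ (i, j)).1 = R i := fun i j => by
    rw [hR]; exact (hcomp i j k₀).1
  have F2 : ∀ i k, (χ (i, k)).1 = R i := fun i k => by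
    rw [← F1 i j₀]; exact (hcomp i j₀ k).1.symm
  have F3 : ∀ j k, (ψ (j, k)).2.2 = C k := fun j k => by
    rw [hC]; exact (hcomp i₀ j k).2.2
  have F4 : ∀ i k, (χ (i, k)).2.2 = C k := fun i k => by
    rw [← F3 j₀ k]; exact (hcomp i j₀ k).2.2.symm
  have F5 : ∀ j k, (ψ (j, k)).1 = M j := fun j k => by
    rw [hM]; exact (hd i₀ j k).1.symm
  have F6 : ∀ i j, (φ (i, j)).2.2 = M j := fun i j => by
    rw [← F5 j k₀]; exact (hd i j k₀).1
  have F7 : ∀ i j k, (φ (i, j)).2.1 * (ψ (j, k)).2.1 = (χ (i, k)).2.1 := fun i j k =>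
    (hcomp i j k).2.1
  -- step 2 (Brandt level): inside fibres the Brandt strictness is the group strictness
  have strict' : ∀ i i' j j' k k', R i = R i' → M j = M j' → C k = C k' →
      (φ (i, j)).2.1 * (ψ (j', k)).2.1 = (χ (i', k')).2.1 → i = i' ∧ j = j' ∧ k = k' := by
    intro i i' j j' k k' hRR hMM hCC hG
    have hcond : (φ (i, j)).2.2 = (ψ (j', k)).1 := by rw [F6, F5]; exact hMM
    have hval : ((φ (i, j)).1, (φ (i, j)).2.1 * (ψ (j', k)).2.1, (ψ (j', k)).2.2) = χ (i', k') := by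
      refine Prod.ext ?_ (Prod.ext hG ?_)
      · show (φ (i, j)).1 = (χ (i', k')).1
        rw [F1, F2]; exact hRR
      · show (ψ (j', k)).2.2 = (χ (i', k')).2.2
        rw [F3, F4]; exact hCC
    obtain ⟨h1, h2, h3⟩ := (H (i, j) (j', k) (i', k')).1 (by rw [if_pos hcond, hval])
    exact ⟨h1.symm, h2, h3.symm⟩
  -- step 3: largest fibres
  obtain ⟨ρ, -, hρ⟩ := exists_max_image (univ : Finset (Fin n))
    (fun ρ => Fintype.card {x // R x = ρ}) ⟨R i₀, mem_univ _⟩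
  obtain ⟨μ, -, hμ⟩ := exists_max_image (univ : Finset (Fin n))
    (fun μ => Fintype.card {x // M x = μ}) ⟨M j₀, mem_univ _⟩
  obtain ⟨ν, -, hν⟩ := exists_max_image (univ : Finset (Fin n))
    (fun ν => Fintype.card {x // C x = ν}) ⟨C k₀, mem_univ _⟩
  have hA : a ≤ n * Fintype.card {x // R x = ρ} :=
    le_mul_card_fiber R ρ fun ρ' => hρ ρ' (mem_univ _)
  have hB : b ≤ n * Fintype.card {x // M x = μ} :=
    le_mul_card_fiber M μ fun μ' => hμ μ' (mem_univ _)
  have hE : e ≤ n * Fintype.card {x // C x = ν} :=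
    le_mul_card_fiber C ν fun ν' => hν ν' (mem_univ _)
  -- the largest fibres are non-empty
  obtain ⟨⟨i₁, hi₁⟩⟩ : Nonempty {x // R x = ρ} := Fintype.card_pos_iff.1
    (lt_of_lt_of_le (Fintype.card_pos_iff.2 ⟨⟨i₀, rfl⟩⟩) (hρ (R i₀) (mem_univ _)))
  obtain ⟨⟨j₁, hj₁⟩⟩ : Nonempty {x // M x = μ} := Fintype.card_pos_iff.1
    (lt_of_lt_of_le (Fintype.card_pos_iff.2 ⟨⟨j₀, rfl⟩⟩) (hμ (M j₀) (mem_univ _)))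
  obtain ⟨⟨k₁, hk₁⟩⟩ : Nonempty {x // C x = ν} := Fintype.card_pos_iff.1
    (lt_of_lt_of_le (Fintype.card_pos_iff.2 ⟨⟨k₀, rfl⟩⟩) (hν (C k₀) (mem_univ _)))
  -- step 2 (group level): the fibres carry a strict realization in `G`, hence a TPP triple
  have hreal : RealizesTPP G (Fintype.card {x // R x = ρ}) (Fintype.card {x // M x = μ})
      (Fintype.card {x // C x = ν}) :=
    realizesTPP_of_realization
      (fun (i : {x // R x = ρ}) (j : {x // M x = μ}) => (φ (i.1, j.1)).2.1)
      (fun (j : {x // M x = μ}) (k : {x // C x = ν}) => (ψ (j.1, k.1)).2.1)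
      (fun (i : {x // R x = ρ}) (k : {x // C x = ν}) => (χ (i.1, k.1)).2.1)
      ⟨i₁, hi₁⟩ ⟨j₁, hj₁⟩ ⟨k₁, hk₁⟩
      (fun i j k => F7 i.1 j.1 k.1)
      (fun i i' j j' k k' hG => by
        obtain ⟨h1, h2, h3⟩ := strict' i.1 i'.1 j.1 j'.1 k.1 k'.1 (i.2.trans i'.2.symm)
          (j.2.trans j'.2.symm) (k.2.trans k'.2.symm) hG
        exact ⟨Subtype.ext h1, Subtype.ext h2, Subtype.ext h3⟩)
  refine ⟨_, _, _, hreal, ?_⟩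
  calc a * b * e ≤ n * Fintype.card {x // R x = ρ} * (n * Fintype.card {x // M x = μ}) *
        (n * Fintype.card {x // C x = ν}) := Nat.mul_le_mul (Nat.mul_le_mul hA hB) hE
    _ = n ^ 3 * (Fintype.card {x // R x = ρ} * Fintype.card {x // M x = μ} *
        Fintype.card {x // C x = ν}) := by ring

end Summit.MatrixMultiplication.MatrixMultiplication.Theorems
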